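import Literature.AnabelianGeometry.AbsoluteAnabelian.MonoidKummerGaloisCyclotome
import Literature.AnabelianGeometry.AbsoluteAnabelian.MonoidKummerModelNaturality
import Literature.AnabelianGeometry.AbsoluteAnabelian.GaloisCyclotomeReciprocityFundamental
import Literature.AnabelianGeometry.AbsoluteAnabelian.MonoidKummerMapsTLGLiftForcesContinuity
import Literature.AnabelianGeometry.AbsoluteAnabelian.MonoidKummerMapsTLGLiftReduction
import Literature.AnabelianGeometry.AbsoluteAnabelian.AbsAnabUnitsTransportOfBiAnabelian
import Literature.AnabelianGeometry.EtaleTheta.GKCyclotomeJunction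
import HarnessLib

/-!
# An isomorphism of model MLF-Galois `TM`-pairs IS a units transport: the covered Galois isomorphism
# is topological, `f_M^gp` is `ᾱ`-equivariant and uniformiser-preserving, and Rmk 3.2.1 is natural along it

S. Mochizuki, *Topics in Absolute Anabelian Geometry III*, §3 (bib key `MochizukiAbsTopIII2015`; kurims
manuscript pages, lit key `paper:url-5493eb38cbb7`): Def. 3.1 (ii) p. 67 (a morphism of MLF-Galois `TM`-pairs
«induces an open injection» — for an isomorphism: an isomorphism — of the arithmetic quotients `Π ↠ G`),
Def. 3.1 (iii) p. 68 (groupification `M ↦ M^gp`), Rmk. 3.1.1 p. 70 (the topology of `G`-sets is determined by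
the algebraic structure), Rmk. 3.2.1 p. 73 («a functorial algorithm for constructing the natural isomorphism
`μ_Ẑ(M_TM) ⥲ μ_Ẑ(G)`»); *The Absolute Anabelian Geometry of Hyperbolic Curves* [AbsAnab], Prop. 1.2.1
(iii)/(iv)/(vi) pp. 10–11 (bib key `MochizukiAbsAnab2004`).

THE POINT (abc-iut cell, layer L4, row «P32ii-MUZHAT-PRESENTATION-INDEP», part 1 of 2; sub-DAG
`plan/L4/SUBDAG-AbsTopIII-Prop32.md` row P32.ii.L11; L4-lead RULING #8c).  For an ISOMORPHISM
`f = (f_Π, f_M) : (Π₁ ↷ 𝒪_k̄₁^⊳) ⥲ (Π₂ ↷ 𝒪_k̄₂^⊳)` of MODEL MLF-Galois `TM`-pairs over two closures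
`(k₁, k̄₁)`, `(k₂, k̄₂)` (abc-iut-L4-t2 `ModelMLFGaloisData.tmPair`; e.g. the change of presentation
`e₂⁻¹ e₁` of an abstract pair, `ModelPresentation.changeIso`):

* `GaloisMonoidPair.Iso.galoisIso f : Gal(k̄₁/k₁) ≃ₜ* Gal(k̄₂/k₂)` — the Galois isomorphism `ᾱ` covered by
  `f_Π` (`ε₂ ∘ f_Π = ᾱ ∘ ε₁`, `galoisIso_aug`; unique, `eq_galoisIso_of_aug`), an isomorphism of
  TOPOLOGICAL groups UNCONDITIONALLY: an isomorphism of pairs forces the continuity of the covered abstract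
  Galois isomorphism (abc-iut-L6-t13's `continuous_galoisMulEquiv_of_equivariant`, Rmk. 3.1.1, applied to
  the induced isomorphism `tlgIso` of model `TLG`-pairs) — no compactness of `Π`, no openness of `ε_k`;
  `absGaloisIso f : G_{k₁} ≃ₜ* G_{k₂}` — the same on Mathlib's absolute Galois groups;
* `GaloisMonoidPair.Iso.unitsAlgClosure f : (k₁^alg)ˣ ≃* (k₂^alg)ˣ` — the groupification
  `f_M^gp = unitsLift f_M : k̄₁ˣ ⥲ k̄₂ˣ` (abc-iut-L4-t2, Def. 3.1 (iii)) read in Mathlib's algebraic closures;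
  `isAlphaEquivariant` and `preservesUniformizers`: `(ᾱ, f_M^gp)` IS a units transport in the sense of
  [AbsAnab] Prop. 1.2.1 (vi)/(vii) (abc-iut-w5-d198 / abc-iut-L4-d3 / abc-iut-L6-t13 `Prop121vii.*`; the
  orientation bit is `+1` because `f_M(π₁)` is INTEGRAL — a monoid isomorphism `𝒪_k̄₁^⊳ ⥲ 𝒪_k̄₂^⊳` cannot
  invert valuations);
* `GaloisMonoidPair.Iso.cyclotome_map_rootsHom_muZhat_map` — the COEFFICIENT SQUARE of Rmk. 3.2.1 along
  `f`: the identifications `Λ(rootsHom) : μ_Ẑ(G_{kᵢ}) ⥲ Λ(k̄ᵢˣ)` (abc-iut-L4-t2 p432641) built from THE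
  local-class-field-theory data (abc-iut-w6-d022 `TorsionReciprocityData.fundamental`) intertwine the
  group-theoretic `μ_Ẑ(ᾱ)` (abc-iut-L4-t1 `muZhat.congr`) with `Λ(f_M^gp)` (`fundamental_muZhatEquiv_congr`,
  abc-iut-L6-t11's transport naturality) — the input of the canonicity of the `μ_Ẑ(G)`-valued Kummer maps
  of Prop. 3.2 (ii) across base fields (sequel file `MonoidKummerGaloisCyclotomeCanonical.lean`).

Every input is a kernel theorem of the tree, consumed BY NAME.  Small DATA definitions only (the induced
`TLG`-isomorphism, the covered Galois isomorphism twice, the units transport, an integer of the base field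
as an element of `𝒪_k̄^⊳`); no `Prop`-valued definition, no instance.  Universe `0`.  HONEST FRAMING:
classical local class field theory / Kummer theory as proved in the tree; nothing here bears on [IUTchIII]
Cor. 3.12; no side is taken; nothing asserts that abc is proved or refuted.
-/

noncomputable section

open scoped nonZeroDivisors

namespace Literature.AnabelianGeometry.AbsoluteAnabelian

open _root_.ValuativeRel Field
open Literature.NumberTheory.GaloisRepresentations

namespace GaloisMonoidPair.Iso

variable {C₁ C₂ : MLFClosure.{0}} {D₁ : ModelMLFGaloisData C₁.k C₁.K} {D₂ : ModelMLFGaloisData C₂.k C₂.K}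
  (f : GaloisMonoidPair.Iso D₁.tmPair D₂.tmPair)

/-! ### §1 The Galois isomorphism covered by an isomorphism of model `TM`-pairs is continuous -/

/-- The isomorphism of model `TLG`-pairs `(Π₁ ↷ k̄₁^×) ⥲ (Π₂ ↷ k̄₂^×)` induced by an isomorphism `f` of the
model `TM`-pairs (Def. 3.1 (iii): groupification `f^gp`, read in `k̄^× = (𝒪_k̄^⊳)^gp` through `gpIsoTLG`).
[cite: MochizukiAbsTopIII2015, Definition 3.1 (iii) p.68] -/
def tlgIso : GaloisMonoidPair.Iso D₁.tlgPair D₂.tlgPair :=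
  ((ModelMLFGaloisData.gpIsoTLG C₁ D₁).symm.trans f.groupification).trans (ModelMLFGaloisData.gpIsoTLG C₂ D₂)

/-- The Galois component of `f.tlgIso` is `f_Π`. [cite: MochizukiAbsTopIII2015, Definition 3.1 (iii) p.68] -/
@[simp] theorem tlgIso_isoPi_apply (g : D₁.Pi) : f.tlgIso.isoPi g = f.isoPi g := rfl

/-- `f_Π` carries `Ker ε₁` onto `Ker ε₂` (the arithmetic kernel of the model `TM`-pair is `Ker ε_k`).
[cite: MochizukiAbsTopIII2015, Definition 3.1 (ii) p.67] -/
theorem map_ker_aug : D₁.aug.ker.map f.isoPi.toMulEquiv.toMonoidHom = D₂.aug.ker := by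
  rw [← ModelMLFGaloisData.tmPair_actionKer C₁ D₁, ← ModelMLFGaloisData.tmPair_actionKer C₂ D₂]
  exact f.map_actionKer

/-- An abstract Galois isomorphism covered by `f_Π` is continuous (the object component of `f.tlgIso` is
equivariant along it; Rmk. 3.1.1). [cite: MochizukiAbsTopIII2015, Remark 3.1.1 p.70] -/
private theorem continuous_galoisMulEquiv (α : (C₁.K ≃ₐ[C₁.k] C₁.K) ≃* (C₂.K ≃ₐ[C₂.k] C₂.K))
    (hα : ∀ g, α (D₁.aug g) = D₂.aug (f.isoPi g)) : Continuous α := by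
  -- adapted from abc-iut-L6-t13's private `continuous_galoisMulEquiv_of_tlgPair_iso`
  refine continuous_galoisMulEquiv_of_equivariant C₁ C₂ α f.tlgIso.isoM fun σ x y hxy => ?_
  obtain ⟨g, rfl⟩ := D₁.aug_surjective σ
  have hxy' : y = (g : D₁.tlgPair.Pi) • x := Subtype.ext hxy
  have h1 := f.tlgIso.smul_comm (g : D₁.tlgPair.Pi) x
  rw [← hxy'] at h1
  have h2 := congrArg (fun z : D₂.tlgPair.M => ((z : (C₂.K)⁰) : C₂.K)) h1
  have h3 : (((f.tlgIso.isoPi g : D₂.tlgPair.Pi) • f.tlgIso.isoM x : D₂.tlgPair.M) : C₂.K) =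
      α (D₁.aug g) ((f.tlgIso.isoM x : (C₂.K)⁰) : C₂.K) := by
    show D₂.aug (f.isoPi g) • ((f.tlgIso.isoM x : (C₂.K)⁰) : C₂.K) = _
    rw [← hα]
    rfl
  exact h2.trans h3

/-- … and so is its inverse (covered by `f_Π⁻¹`). [cite: MochizukiAbsTopIII2015, Remark 3.1.1 p.70] -/
private theorem continuous_galoisMulEquiv_symm (α : (C₁.K ≃ₐ[C₁.k] C₁.K) ≃* (C₂.K ≃ₐ[C₂.k] C₂.K))
    (hα : ∀ g, α (D₁.aug g) = D₂.aug (f.isoPi g)) : Continuous α.symm := by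
  -- adapted from abc-iut-L6-t13's private `continuous_galoisMulEquiv_symm_of_tlgPair_iso`
  have hαs : ∀ h, α.symm (D₂.aug h) = D₁.aug (f.isoPi.symm h) := fun h => by
    rw [MulEquiv.symm_apply_eq, hα, ContinuousMulEquiv.apply_symm_apply]
  refine continuous_galoisMulEquiv_of_equivariant C₂ C₁ α.symm f.tlgIso.isoM.symm fun τ x y hxy => ?_
  obtain ⟨h, rfl⟩ := D₂.aug_surjective τ
  have hxy' : y = (h : D₂.tlgPair.Pi) • x := Subtype.ext hxy
  have h1 := f.tlgIso.symm_smul_comm (h : D₂.tlgPair.Pi) x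
  rw [← hxy'] at h1
  have h2 := congrArg (fun z : D₁.tlgPair.M => ((z : (C₁.K)⁰) : C₁.K)) h1
  have h3 : (((f.tlgIso.isoPi.symm h : D₁.tlgPair.Pi) • f.tlgIso.isoM.symm x : D₁.tlgPair.M) : C₁.K) =
      α.symm (D₂.aug h) ((f.tlgIso.isoM.symm x : (C₁.K)⁰) : C₁.K) := by
    show D₁.aug (f.isoPi.symm h) • ((f.tlgIso.isoM.symm x : (C₁.K)⁰) : C₁.K) = _
    rw [hαs]
    rfl
  exact h2.trans h3

/-- **The Galois isomorphism `ᾱ : Gal(k̄₁/k₁) ⥲ Gal(k̄₂/k₂)` covered by an isomorphism of model `TM`-pairs,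
as an isomorphism of TOPOLOGICAL groups, UNCONDITIONALLY** (Def. 3.1 (ii): the Galois component «induces an
isomorphism» of the arithmetic quotients; continuity is forced by the object component, Rmk. 3.1.1).
[cite: MochizukiAbsTopIII2015, Definition 3.1 (ii) p.67] -/
def galoisIso : (C₁.K ≃ₐ[C₁.k] C₁.K) ≃ₜ* (C₂.K ≃ₐ[C₂.k] C₂.K) :=
  { Classical.choose (ModelMLFGaloisData.exists_galoisMulEquiv_of_map_ker_eq D₁ D₂ f.isoPi f.map_ker_aug) with
    continuous_toFun := f.continuous_galoisMulEquiv _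
      (Classical.choose_spec (ModelMLFGaloisData.exists_galoisMulEquiv_of_map_ker_eq D₁ D₂ f.isoPi f.map_ker_aug))
    continuous_invFun := f.continuous_galoisMulEquiv_symm _
      (Classical.choose_spec (ModelMLFGaloisData.exists_galoisMulEquiv_of_map_ker_eq D₁ D₂ f.isoPi f.map_ker_aug)) }

/-- `ᾱ ∘ ε₁ = ε₂ ∘ f_Π`. [cite: MochizukiAbsTopIII2015, Definition 3.1 (ii) p.67] -/
theorem galoisIso_aug (g : D₁.Pi) : f.galoisIso (D₁.aug g) = D₂.aug (f.isoPi g) :=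
  Classical.choose_spec (ModelMLFGaloisData.exists_galoisMulEquiv_of_map_ker_eq D₁ D₂ f.isoPi f.map_ker_aug) g

/-- `ᾱ⁻¹ ∘ ε₂ = ε₁ ∘ f_Π⁻¹`. [cite: MochizukiAbsTopIII2015, Definition 3.1 (ii) p.67] -/
theorem galoisIso_symm_aug (h : D₂.Pi) : f.galoisIso.symm (D₂.aug h) = D₁.aug (f.isoPi.symm h) := by
  apply f.galoisIso.injective
  rw [ContinuousMulEquiv.apply_symm_apply, galoisIso_aug, ContinuousMulEquiv.apply_symm_apply]

/-- `ᾱ` is THE covered isomorphism: any group isomorphism `α` with `α ∘ ε₁ = ε₂ ∘ f_Π` is `ᾱ` (`ε₁` is onto).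
[cite: MochizukiAbsTopIII2015, Definition 3.1 (ii) p.67] -/
theorem eq_galoisIso_of_aug (α : (C₁.K ≃ₐ[C₁.k] C₁.K) ≃* (C₂.K ≃ₐ[C₂.k] C₂.K))
    (hα : ∀ g, α (D₁.aug g) = D₂.aug (f.isoPi g)) (σ : C₁.K ≃ₐ[C₁.k] C₁.K) : α σ = f.galoisIso σ := by
  obtain ⟨g, rfl⟩ := D₁.aug_surjective σ
  rw [hα, galoisIso_aug]

/-- **`ᾱ` on Mathlib's absolute Galois groups** `G_{k₁} ⥲ G_{k₂}` (independence of the algebraic closure,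
`algEquivContinuousMulEquivAbsoluteGaloisGroup`). [cite: MochizukiAbsTopIII2015, Definition 3.1 (ii) p.67] -/
def absGaloisIso : absoluteGaloisGroup C₁.k ≃ₜ* absoluteGaloisGroup C₂.k :=
  ((algEquivContinuousMulEquivAbsoluteGaloisGroup C₁.k C₁.K).symm.trans f.galoisIso).trans
    (algEquivContinuousMulEquivAbsoluteGaloisGroup C₂.k C₂.K)

/-- `ᾱ ∘ augGal₁ = augGal₂ ∘ f_Π` (`augGal = (Aut_k(k̄) ⥲ G_k) ∘ ε_k`). [cite: MochizukiAbsTopIII2015, Definition 3.1 (ii) p.67] -/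
theorem absGaloisIso_augGal (g : D₁.Pi) : f.absGaloisIso (D₁.augGal C₁ g) = D₂.augGal C₂ (f.isoPi g) := by
  show algEquivContinuousMulEquivAbsoluteGaloisGroup C₂.k C₂.K (f.galoisIso
      ((algEquivContinuousMulEquivAbsoluteGaloisGroup C₁.k C₁.K).symm
        (algEquivContinuousMulEquivAbsoluteGaloisGroup C₁.k C₁.K (D₁.aug g)))) =
    algEquivContinuousMulEquivAbsoluteGaloisGroup C₂.k C₂.K (D₂.aug (f.isoPi g))
  rw [ContinuousMulEquiv.symm_apply_apply, galoisIso_aug]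

/-- `augGal` is onto (`ε_k` is). [cite: MochizukiAbsTopIII2015, Definition 3.1 (i) p.66] -/
theorem augGal_surjective (C : MLFClosure.{0}) (D : ModelMLFGaloisData C.k C.K) : Function.Surjective (D.augGal C) :=
  (algEquivContinuousMulEquivAbsoluteGaloisGroup C.k C.K).surjective.comp D.aug_surjective

/-! ### §2 The units transport `f_M^gp : k̄₁ˣ ⥲ k̄₂ˣ`, read in the algebraic closures -/

/-- **`f_M^gp` on Mathlib's algebraic closures**: `(k₁^alg)ˣ ⥲ k̄₁ˣ ⥲ k̄₂ˣ ⥲ (k₂^alg)ˣ`, the middle arrow the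
groupification `unitsLift f_M` of `f_M : 𝒪_k̄₁^⊳ ⥲ 𝒪_k̄₂^⊳` (Def. 3.1 (iii)).
[cite: MochizukiAbsTopIII2015, Definition 3.1 (iii) p.68] -/
def unitsAlgClosure : (AlgebraicClosure C₁.k)ˣ ≃* (AlgebraicClosure C₂.k)ˣ :=
  ((Units.mapEquiv (C₁.toAlgClosure.symm : AlgebraicClosure C₁.k ≃* C₁.K)).trans
      (ModelMLFGaloisData.unitsLiftEquiv f.isoM)).trans
    (Units.mapEquiv (C₂.toAlgClosure : C₂.K ≃* AlgebraicClosure C₂.k))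

/-- Values of `f.unitsAlgClosure`. [cite: MochizukiAbsTopIII2015, Definition 3.1 (iii) p.68] -/
theorem coe_unitsAlgClosure (x : (AlgebraicClosure C₁.k)ˣ) :
    ((f.unitsAlgClosure x : (AlgebraicClosure C₂.k)ˣ) : AlgebraicClosure C₂.k) =
      C₂.toAlgClosure ((ModelMLFGaloisData.unitsLift f.isoM.toMonoidHom
        (Units.map (C₁.toAlgClosure.symm : AlgebraicClosure C₁.k →* C₁.K) x) : C₂.K)) :=
  rfl

/-- Read back in `k̄₂`, `f.unitsAlgClosure` is `unitsLift f_M` (read in `k̄₁`).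
[cite: MochizukiAbsTopIII2015, Definition 3.1 (iii) p.68] -/
theorem map_toAlgClosure_symm_unitsAlgClosure (x : (AlgebraicClosure C₁.k)ˣ) :
    Units.map (C₂.toAlgClosure.symm : AlgebraicClosure C₂.k →* C₂.K) (f.unitsAlgClosure x) =
      ModelMLFGaloisData.unitsLift f.isoM.toMonoidHom
        (Units.map (C₁.toAlgClosure.symm : AlgebraicClosure C₁.k →* C₁.K) x) :=
  Units.ext (by rw [Units.coe_map, MonoidHom.coe_coe, coe_unitsAlgClosure, AlgEquiv.symm_apply_apply])

/-- Reading `σ • x` (`σ = augGal₁ g`) back in `k̄₁`: it is `g • (x read in k̄₁)`.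
[cite: MochizukiAbsTopIII2015, Definition 3.1 (i) p.66] -/
theorem map_toAlgClosure_symm_smul (C : MLFClosure.{0}) (D : ModelMLFGaloisData C.k C.K) (g : D.Pi)
    (x : (AlgebraicClosure C.k)ˣ) :
    Units.map (C.toAlgClosure.symm : AlgebraicClosure C.k →* C.K) (D.augGal C g • x) =
      g • Units.map (C.toAlgClosure.symm : AlgebraicClosure C.k →* C.K) x := by
  apply Units.ext
  rw [Units.coe_map, MonoidHom.coe_coe, Units.coe_smul, ModelMLFGaloisData.augGal_smul,
    AlgEquiv.symm_apply_apply, ModelMLFGaloisData.units_coe_smul, Units.coe_map, MonoidHom.coe_coe,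
    AlgEquiv.smul_def]

/-- **`f_M^gp` is `ᾱ`-equivariant** ([AbsAnab] Prop. 1.2.1 (vi) «Galois-equivariant with respect to `α`»):
`f_M^gp(σ • x) = ᾱ(σ) • f_M^gp(x)` (equivariance of `f`, `unitsLift_smul`).
[cite: MochizukiAbsAnab2004, Prop 1.2.1 (vi) p.10] -/
theorem isAlphaEquivariant : Prop121vii.IsAlphaEquivariant f.absGaloisIso f.unitsAlgClosure := by
  intro σ x
  obtain ⟨g, rfl⟩ := augGal_surjective C₁ D₁ σ
  apply (Units.mapEquiv (C₂.toAlgClosure.symm : AlgebraicClosure C₂.k ≃* C₂.K)).injective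
  change Units.map (C₂.toAlgClosure.symm : AlgebraicClosure C₂.k →* C₂.K) (f.unitsAlgClosure (D₁.augGal C₁ g • x)) =
    Units.map (C₂.toAlgClosure.symm : AlgebraicClosure C₂.k →* C₂.K) (f.absGaloisIso (D₁.augGal C₁ g) • f.unitsAlgClosure x)
  rw [absGaloisIso_augGal, map_toAlgClosure_symm_smul, map_toAlgClosure_symm_unitsAlgClosure,
    map_toAlgClosure_symm_unitsAlgClosure, map_toAlgClosure_symm_smul,
    ModelMLFGaloisData.unitsLift_smul f.isoM.toMonoidHom f.isoPi.toMonoidHom f.smul_comm]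
  rfl

/-- The element of `𝒪_k̄^⊳` given by an integer of the base field `k`. [cite: MochizukiAbsTopIII2015, Definition 3.1 (i) p.66] -/
def ofInteger (C : MLFClosure.{0}) (c : C.kˣ) (hc : valuation C.k (c : C.k) ≤ 1) : nonzeroIntegers C.k C.K :=
  ⟨algebraMap C.k C.K c, ⟨(mem_integersClosure_iff_isIntegral C.k C.K).mpr
      ((isIntegral_algebraMap_iff_mem_integer C.k C.K).mpr ((Valuation.mem_integer_iff _ _).mpr hc)),
    (map_ne_zero _).mpr c.ne_zero⟩⟩

/-- `ofInteger c` read in `(k^alg)ˣ` is the image of `c`. [cite: MochizukiAbsTopIII2015, Definition 3.1 (i) p.66] -/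
theorem map_toAlgClosure_symm_unitsMap_algebraMap (C : MLFClosure.{0}) (c : C.kˣ) (hc : valuation C.k (c : C.k) ≤ 1) :
    Units.map (C.toAlgClosure.symm : AlgebraicClosure C.k →* C.K)
        (Units.map (algebraMap C.k (AlgebraicClosure C.k) : C.k →* AlgebraicClosure C.k) c) =
      ModelMLFGaloisData.toUnit (ofInteger C c hc) :=
  Units.ext (by
    rw [Units.coe_map, MonoidHom.coe_coe, Units.coe_map, MonoidHom.coe_coe, AlgEquiv.commutes]
    rfl)

/-- **`f_M^gp` carries uniformisers of `k₁` to uniformisers of `k₂`** ([AbsAnab] Prop. 1.2.1 (iv)): by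
abc-iut-L6-t13's orientation analysis an `ᾱ`-equivariant `ψ̄` sends a uniformiser `π₁` to `c ∈ k₂ˣ` with
`v(c) = v(π₂)^{±1}`; here `c = f_M(π₁)` is INTEGRAL (it lies in `𝒪_k̄₂^⊳`), which excludes the sign `−1`.
[cite: MochizukiAbsAnab2004, Prop 1.2.1 (iv) p.10] -/
theorem preservesUniformizers : Prop121vii.PreservesUniformizers f.unitsAlgClosure := by
  obtain ⟨π₁, c, m, hπ₁, hc, hm, hm1⟩ := f.isAlphaEquivariant.exists_image_uniformizer
  -- `c` is integral: it is `f_M(π₁)` read in `k₂^alg`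
  have hπ₁le : valuation C₁.k (π₁ : C₁.k) ≤ 1 := by
    rw [(isUniformizer_iff_valuation_eq_unifValue C₁.k _).mp hπ₁]
    exact (unifValue_lt_one C₁.k).le
  have hcint : IsIntegral 𝒪[C₂.k] (algebraMap C₂.k (AlgebraicClosure C₂.k) (c : C₂.k)) := by
    have h1 : algebraMap C₂.k (AlgebraicClosure C₂.k) (c : C₂.k) =
        ((f.unitsAlgClosure (Units.map (algebraMap C₁.k (AlgebraicClosure C₁.k) : C₁.k →* AlgebraicClosure C₁.k) π₁) :
          (AlgebraicClosure C₂.k)ˣ) : AlgebraicClosure C₂.k) := by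
      rw [← hc, Units.coe_map, MonoidHom.coe_coe]
    rw [h1, coe_unitsAlgClosure, map_toAlgClosure_symm_unitsMap_algebraMap C₁ π₁ hπ₁le,
      ModelMLFGaloisData.unitsLift_toUnit]
    exact ((mem_integersClosure_iff_isIntegral C₂.k C₂.K).mp (f.isoM (ofInteger C₁ π₁ hπ₁le)).2.1).map
      (C₂.toAlgClosure.toAlgHom.restrictScalars 𝒪[C₂.k])
  have hcle : valuation C₂.k (c : C₂.k) ≤ 1 :=
    (Valuation.mem_integer_iff _ _).mp ((isIntegral_algebraMap_iff_mem_integer C₂.k _).mp hcint)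
  -- hence the orientation bit is `+1`
  have hm' : m = 1 := by
    rcases hm1 with h | h
    · exact h
    · exfalso
      rw [hm, h, zpow_neg, zpow_one] at hcle
      have h2 : (1 : _) ≤ unifValue C₂.k := (inv_le_one₀ (unifValue_pos C₂.k)).mp hcle
      exact (not_le.mpr (unifValue_lt_one C₂.k)) h2
  refine f.isAlphaEquivariant.preservesUniformizers_of_image hπ₁ hc ?_
  rw [isUniformizer_iff_valuation_eq_unifValue, hm, hm', zpow_one]

/-! ### §3 The coefficient square: Rmk 3.2.1's identifications intertwine `μ_Ẑ(ᾱ)` with `Λ(f_M^gp)` -/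

/-- **The coefficient square for THE reciprocity data** ([AbsTopIII] Rmk. 3.2.1 «natural isomorphism
`μ_Ẑ(M_TM) ⥲ μ_Ẑ(G)`» along an isomorphism of pairs; [AbsAnab] Prop. 1.2.1 (vi)):
`Λ(rootsHom₂) ∘ μ_Ẑ(ᾱ) = Λ(unitsLift f_M) ∘ Λ(rootsHom₁)` on `μ_Ẑ(G_{k₁})`, where
`rootsHomᵢ : μ_{ℚ/ℤ}(G_{kᵢ}) ↪ k̄ᵢˣ` are built from the FUNDAMENTAL data (`TorsionReciprocityData.fundamental`).
[cite: MochizukiAbsTopIII2015, Remark 3.2.1 p.73] -/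
theorem cyclotome_map_rootsHom_muZhat_map (ζ : muZhat (absoluteGaloisGroup C₁.k)) :
    EtaleTheta.cyclotome.map (ModelMLFGaloisData.rootsHom C₂ (TorsionReciprocityData.fundamental C₂.k))
        (muZhat.map f.absGaloisIso ζ) =
      EtaleTheta.cyclotome.map (ModelMLFGaloisData.unitsLift f.isoM.toMonoidHom)
        (EtaleTheta.cyclotome.map (ModelMLFGaloisData.rootsHom C₁ (TorsionReciprocityData.fundamental C₁.k)) ζ) := by
  have key := TorsionReciprocityData.fundamental_muZhatEquiv_congr f.absGaloisIso f.isAlphaEquivariant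
    f.preservesUniformizers ζ
  rw [muZhat.coe_congr] at key
  rw [ModelMLFGaloisData.map_rootsHom_eq, ModelMLFGaloisData.map_rootsHom_eq, key,
    EtaleTheta.cyclotome.map_map, EtaleTheta.cyclotome.map_map]
  have hφ : (Units.map (C₂.toAlgClosure.symm : AlgebraicClosure C₂.k →* C₂.K)).comp f.unitsAlgClosure.toMonoidHom =
      (ModelMLFGaloisData.unitsLift f.isoM.toMonoidHom).comp
        (Units.map (C₁.toAlgClosure.symm : AlgebraicClosure C₁.k →* C₁.K)) :=
    MonoidHom.ext fun x => f.map_toAlgClosure_symm_unitsAlgClosure x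
  rw [hφ]


end GaloisMonoidPair.Iso

end Literature.AnabelianGeometry.AbsoluteAnabelian

end
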